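import Literature.MathematicalPhysics.QuantumFieldTheory.BalabanImbrieJaffe1984to88.BIJ88RenormTransf311

/-!
# `BalabanImbrieJaffe1984to88.BIJ88Rho0Integrable` — T. Bałaban, J. Imbrie, A. Jaffe, *Effective action and cluster properties of the
abelian Higgs model*, Commun. Math. Phys. **114** (1988) 257–315 [BalabanImbrieJaffe1988], pp. 265–266: the density `ρ₀(u, φ) = F e^{−S}`
of **(3.6)–(3.7)** is `𝒟u𝒟φ`-INTEGRABLE for the observables of **(3.1)** — the stability bound `S^ε(u, φ) ≥ Σ_x ε^d(|φ(x)|² − K) + E₀ + E₁`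
of the Wilson–Higgs action **(3.3)–(3.4)** (Wilson and kinetic terms `≥ 0`, quartic potential coercive), whence `|ρ₀| ≤ const·Π_x
(1 + |φ(x)|)ⁿ e^{−a|φ(x)|²}`, a product of one-site Gaussian-dominated integrable functions.

statement-level skeleton of published theorems with citation tags; proofs where landed; nothing here is a claim about the Yang–Mills mass gap

PDF held: `paper:balaban1988-cmp114-bij-abelian-higgs-effective-action` (journal page = PDF page + 256); p. 265–266 [PDF 9–10] read as
images (`HOME/lit-balaban-r18/renders/c2/c2-p009a/b.png`, `c2-p010a/b.png` of the r18 seat folders).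

CITATION HEADER (lean-in-tree rule).  Part of the lit-balaban TYPED SKELETON (HOME `run/shared/lean/pub/lit-balaban/`), unit `lit-balaban-r18`
gen 4 (fold owner of C2 Sects. 1–4).  Serves rows `C2.Eq3.1`, `C2.Eq3.6`, `C2.Eq3.11`, `C2.Eq3.13` of `HOME/lit-balaban-r18/ROWS-C2.md`: the
integrability HYPOTHESIS `hFi : Integrable (uncurry (rho0 …))` of r18's `BIJ88RenormTransf311.eq313` and of p34's
`BIJ88RT311Exists.isRT311_rt` / `eq313_rt` is DISCHARGED for every jointly measurable observable of polynomial growth in the scalar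
field — in particular for the printed class of (3.1).

THE PRINTED TEXT (p. 265 [PDF 9], verbatim).  *"Let us study the (unnormalized) expectation [F] = ∫𝒟u𝒟φ e^{−S^ε(u,φ)}F. (3.1) Here F is
a gauge invariant function of u, φ. For example, we can let F be a product of factors |φ(x)|², or \overline{φ(b₋)}u(b)φ(b₊) or
Re(ieε²)^{−1}(u(p) − 1), where x, b, p, are respectively sites, bonds, or plaquettes on the lattice T_ε. … The action on T_ε, the
ε-lattice, is S^ε(u, φ) = Σ_{p∈T_ε^{**}} ε^d (1/(e²ε⁴))[1 − Re u(p)] + ½⟨φ, −Δ^ε_uφ⟩ + Σ_{x∈T_ε} ε^dP(φ(x)) + E₀ + E₁. (3.3) Here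
−Δ^ε_u = D^{ε*}_uD^ε_u and P(φ) = λ|φ|⁴ − ¼|φ|² + 1/(64λ) − ½δm²|φ|². (3.4)"*; p. 266: *"we first rescale to the unit lattice, so
[F] = ∫𝒟u𝒟φ ρ₀(u, φ), (3.6)"*.

WHAT IS PROVED (0 `sorry`, standard axioms, no `Prop`-valued fact introduced; carriers of record: `BIJ88Sect3Statements.actionU1`/`higgsP`
for (3.3)/(3.4), `BIJ88RenormTransf311.rho0` for (3.7), `fieldMeasure P j U1 ⊗ volume` = `𝒟u𝒟φ`).
* §1 stability of the action: `higgsP_ge` — `P(φ) ≥ |φ|² − (5/4 + δm²/2)²/(4λ)` for `λ > 0` (completing the square); `wilson_nonneg`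
  (`1 − Re u(p) ≥ 0` on `U(1)` configurations, coefficient `ε^d/(e²ε⁴) ≥ 0`), `kinetic_nonneg`; hence `actionU1_ge`:
  `S ≥ Σ_x w(|φ(x)|² − K) + E₀ + E₁` (`w ≥ 0`).
* §2 the observables: polynomial growth `|F(u, φ)| ≤ C Π_x (1 + |φ(x)|)ⁿ` (an explicit hypothesis; no predicate declared) — satisfied by
  the printed factors (`norm_normSq_le`: `|φ(x)|²`; `norm_string_le`: `\overline{φ(b₋)}u(b)φ(b₊)`; `norm_plaq_le`: `Re(ieε²)^{−1}(u(p) − 1)`,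
  and `norm_le_mul_prod_of_bounded` for any bounded `F`; `norm_mul_le_of_le`: products) and stable under the rescaling `φ ↦ ε^{−(d−2)/2}φ`
  of (3.6) (`norm_smul_le_of_le`).
* §3 **`integrable_rho0`**: for `ε > 0`, `λ > 0` and a jointly measurable `F` of polynomial growth, the density `ρ₀ = rho0 ε e λ δm² E₀ E₁ F`
  is integrable for `𝒟u𝒟φ = (fieldMeasure P j U1).prod volume` — domination by `A·Π_x (1 + |φ(x)|)ⁿe^{−a|φ(x)|²}`, `a = ε^d·ε^{2−d} > 0`,
  each factor `≤ e^{n²/(2a)}e^{−(a/2)|z|²}` (one-site complex Gaussian, integrable: `BIJ88Sect3Normalization.integral_exp_neg_mul_sq_norm_sub`),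
  product integrable by `Integrable.fintype_prod`, `𝒟u` a probability measure.
NOT DONE HERE: gauge invariance of the printed factors (r18's `BIJ88Sect3Statements.stringVar_gauge` etc. are the relevant decls); nothing on
(3.13) itself (r18's `eq313`, p34's `eq313_rt` take `integrable_rho0` as input).  Imports: `BIJ88RenormTransf311` only; standard axioms.
-/

namespace Literature.MathematicalPhysics.QuantumFieldTheory.BalabanImbrieJaffe1984to88.BIJ88Rho0Integrable

open Literature.MathematicalPhysics.QuantumFieldTheory.Balaban1983to89
open BIJ88Sect3Statements (U1 toC norm_toC cfg covD plaqVar plaqVar_cfg higgsP action actionU1 calE0)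
open BIJ85Sect1Model (HiggsField)
open BIJ88Sect3Rescaling (phiScale phiScale_pos)
open BIJ88RenormTransf311 (rho0 measurable_rho0)
open scoped BigOperators
open _root_.MeasureTheory Complex Finset

noncomputable section

variable {P : Params} {j : ℕ}

/-! ## §1 Stability of the action (3.3)–(3.4) -/

/-- **(3.4) is coercive**: `P(φ) ≥ |φ|² − (5/4 + δm²/2)²/(4λ)` for `λ > 0` — completing the square
`λ|φ|⁴ − (¼ + ½δm² + 1)|φ|² + (5/4 + δm²/2)²/(4λ) = λ(|φ|² − (5/4 + δm²/2)/(2λ))² ≥ 0`. [cite: BalabanImbrieJaffe1988, (3.4) p.265] -/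
theorem higgsP_ge {lam : ℝ} (hlam : 0 < lam) (dm2 : ℝ) (z : ℂ) :
    ‖z‖ ^ 2 - (5 / 4 + dm2 / 2) ^ 2 / (4 * lam) ≤ higgsP lam dm2 z := by
  have hl : lam ≠ 0 := hlam.ne'
  have key : higgsP lam dm2 z - (‖z‖ ^ 2 - (5 / 4 + dm2 / 2) ^ 2 / (4 * lam)) =
      lam * (‖z‖ ^ 2 - (5 / 4 + dm2 / 2) / (2 * lam)) ^ 2 + 1 / (64 * lam) := by
    unfold higgsP
    field_simp
    ring
  have h1 : 0 ≤ lam * (‖z‖ ^ 2 - (5 / 4 + dm2 / 2) / (2 * lam)) ^ 2 := by positivity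
  have h2 : 0 ≤ 1 / (64 * lam) := by positivity
  linarith

/-- kernel: a plaquette variable of a `U(1)` configuration has modulus `1`. [cite: BalabanImbrieJaffe1988, (3.3) p.265] -/
theorem norm_plaqVar_cfg (U : GaugeField P j U1) (p : Balaban1983to89.Plaq P j) : ‖plaqVar (cfg U) p‖ = 1 := by
  rw [plaqVar_cfg, norm_toC]

/-- **The Wilson term of (3.3) is non-negative**: `Σ_p ε^d(e²ε⁴)⁻¹[1 − Re u(p)] ≥ 0` (`|u(p)| = 1`, `w ≥ 0`). [cite: BalabanImbrieJaffe1988, (3.3) p.265] -/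
theorem wilson_nonneg {w : ℝ} (hw : 0 ≤ w) (c e : ℝ) (U : GaugeField P j U1) :
    0 ≤ ∑ p : Balaban1983to89.Plaq P j, w * (c ^ 4 / e ^ 2) * (1 - (plaqVar (cfg U) p).re) := by
  refine sum_nonneg fun p _ => mul_nonneg (mul_nonneg hw ?_) ?_
  · have : 0 ≤ c ^ 4 := by positivity
    have : 0 ≤ e ^ 2 := by positivity
    positivity
  · have h := Complex.re_le_norm (plaqVar (cfg U) p)
    rw [norm_plaqVar_cfg] at h
    linarith

/-- **The kinetic term of (3.3) is non-negative**: `½⟨φ, −Δ^ε_uφ⟩ = ½Σ_b ε^d|(D^ε_uφ)(b)|² ≥ 0`. [cite: BalabanImbrieJaffe1988, (3.3) p.265] -/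
theorem kinetic_nonneg {w : ℝ} (hw : 0 ≤ w) (c : ℝ) (u : PBond P j → ℂ) (φ : Balaban1983to89.Site P j → ℂ) :
    0 ≤ (1 / 2) * ∑ b : PBond P j, w * ‖covD c u φ b‖ ^ 2 :=
  mul_nonneg (by norm_num) (sum_nonneg fun b _ => by positivity)

/-- **STABILITY of (3.3)–(3.4)**: `S^ε(u, φ) ≥ Σ_x w(|φ(x)|² − (5/4 + δm²/2)²/(4λ)) + E₀ + E₁` for `U(1)` configurations, `w ≥ 0`, `λ > 0`.
[cite: BalabanImbrieJaffe1988, (3.3) p.265] -/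
theorem actionU1_ge {w : ℝ} (hw : 0 ≤ w) (c e : ℝ) {lam : ℝ} (hlam : 0 < lam) (dm2 E₀ E₁ : ℝ) (U : GaugeField P j U1)
    (φ : Balaban1983to89.Site P j → ℂ) :
    (∑ x : Balaban1983to89.Site P j, w * (‖φ x‖ ^ 2 - (5 / 4 + dm2 / 2) ^ 2 / (4 * lam))) + E₀ + E₁ ≤
      actionU1 w c e lam dm2 E₀ E₁ U φ := by
  unfold actionU1 action
  have h1 := wilson_nonneg hw c e U
  have h2 := kinetic_nonneg hw c (cfg U) φ
  have h3 : ∑ x : Balaban1983to89.Site P j, w * (‖φ x‖ ^ 2 - (5 / 4 + dm2 / 2) ^ 2 / (4 * lam)) ≤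
      ∑ x : Balaban1983to89.Site P j, w * higgsP lam dm2 (φ x) :=
    sum_le_sum fun x _ => mul_le_mul_of_nonneg_left (higgsP_ge hlam dm2 (φ x)) hw
  linarith

/-! ## §2 The observables of (3.1): polynomial growth in the scalar field

The growth class used below is `|F(u, φ)| ≤ C Π_x (1 + |φ(x)|)ⁿ` (polynomial growth in the scalar field, uniformly in the gauge
field), written out as an explicit hypothesis in every statement (no predicate is declared); the printed factors of (3.1) and their
products satisfy it (`norm_normSq_le`, `norm_string_le`, `norm_plaq_le`, `norm_mul_le_of_le`), and it is stable under the rescaling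
`φ ↦ sφ` of (3.6) (`norm_smul_le_of_le`). -/

/-- kernel: a product of real factors `≥ 1` is `≥ 1`. [folklore] -/
private theorem one_le_prod_real {ι : Type*} (s : Finset ι) {f : ι → ℝ} (h : ∀ i ∈ s, 1 ≤ f i) :
    1 ≤ ∏ i ∈ s, f i :=
  calc (1 : ℝ) = ∏ _i ∈ s, (1 : ℝ) := Finset.prod_const_one.symm
    _ ≤ ∏ i ∈ s, f i := Finset.prod_le_prod (fun _ _ => zero_le_one) h

/-- kernel: the weight `Π_x (1 + |φ(x)|)ⁿ` of the growth class of (3.1) is `≥ 1`. [cite: BalabanImbrieJaffe1988, (3.1) p.265] -/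
theorem one_le_prod_pow (n : ℕ) (φ : HiggsField P j) : 1 ≤ ∏ x : Balaban1983to89.Site P j, (1 + ‖φ x‖) ^ n :=
  one_le_prod_real _ fun x _ => one_le_pow₀ (by have := norm_nonneg (φ x); linarith)

/-- **The factor `|φ(x)|²` of (3.1)** has polynomial growth (`C = 1`, `n = 2`). [cite: BalabanImbrieJaffe1988, (3.1) p.265] -/
theorem norm_normSq_le (x₀ : Balaban1983to89.Site P j) (φ : HiggsField P j) :
    ‖(((‖φ x₀‖ ^ 2 : ℝ)) : ℂ)‖ ≤ 1 * ∏ x : Balaban1983to89.Site P j, (1 + ‖φ x‖) ^ 2 := by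
  rw [one_mul, Complex.norm_real, Real.norm_eq_abs, abs_of_nonneg (by positivity)]
  have h1 : ‖φ x₀‖ ^ 2 ≤ (1 + ‖φ x₀‖) ^ 2 := by
    have := norm_nonneg (φ x₀); nlinarith
  refine h1.trans ?_
  rw [← Finset.prod_erase_mul _ _ (Finset.mem_univ x₀)]
  have h2 : 1 ≤ ∏ x ∈ Finset.univ.erase x₀, (1 + ‖φ x‖) ^ 2 :=
    one_le_prod_real _ fun x _ => one_le_pow₀ (by have := norm_nonneg (φ x); linarith)
  have h3 : 0 ≤ (1 + ‖φ x₀‖) ^ 2 := by positivity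
  nlinarith

/-- **The factor `\overline{φ(b₋)}u(b)φ(b₊)` of (3.1)** has polynomial growth (`C = 1`, `n = 2`; `|u(b)| = 1`).
[cite: BalabanImbrieJaffe1988, (3.1) p.265] -/
theorem norm_string_le (b : PBond P j) (U : GaugeField P j U1) (φ : HiggsField P j) :
    ‖(starRingEnd ℂ) (φ b.src) * toC (U b) * φ b.tgt‖ ≤ 1 * ∏ x : Balaban1983to89.Site P j, (1 + ‖φ x‖) ^ 2 := by
  rw [one_mul, norm_mul, norm_mul, Complex.norm_conj, norm_toC, mul_one]
  by_cases hst : b.src = b.tgt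
  · rw [hst]
    have h1 : ‖φ b.tgt‖ * ‖φ b.tgt‖ ≤ (1 + ‖φ b.tgt‖) ^ 2 := by have := norm_nonneg (φ b.tgt); nlinarith
    refine h1.trans ?_
    rw [← Finset.prod_erase_mul _ _ (Finset.mem_univ b.tgt)]
    have h2 : 1 ≤ ∏ x ∈ Finset.univ.erase b.tgt, (1 + ‖φ x‖) ^ 2 :=
      one_le_prod_real _ fun x _ => one_le_pow₀ (by have := norm_nonneg (φ x); linarith)
    have h3 : 0 ≤ (1 + ‖φ b.tgt‖) ^ 2 := by positivity
    nlinarith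
  · have hmem : b.src ∈ Finset.univ.erase b.tgt := Finset.mem_erase.2 ⟨hst, Finset.mem_univ _⟩
    rw [← Finset.prod_erase_mul _ _ (Finset.mem_univ b.tgt), ← Finset.prod_erase_mul _ _ hmem]
    have h2 : 1 ≤ ∏ x ∈ (Finset.univ.erase b.tgt).erase b.src, (1 + ‖φ x‖) ^ 2 :=
      one_le_prod_real _ fun x _ => one_le_pow₀ (by have := norm_nonneg (φ x); linarith)
    have ha : ‖φ b.src‖ ≤ (1 + ‖φ b.src‖) ^ 2 := by have := norm_nonneg (φ b.src); nlinarith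
    have hb : ‖φ b.tgt‖ ≤ (1 + ‖φ b.tgt‖) ^ 2 := by have := norm_nonneg (φ b.tgt); nlinarith
    have h0b := norm_nonneg (φ b.tgt)
    calc ‖φ b.src‖ * ‖φ b.tgt‖ ≤ (1 + ‖φ b.src‖) ^ 2 * (1 + ‖φ b.tgt‖) ^ 2 :=
          mul_le_mul ha hb h0b (by positivity)
      _ = 1 * (1 + ‖φ b.src‖) ^ 2 * (1 + ‖φ b.tgt‖) ^ 2 := by ring
      _ ≤ _ := by
          have h4 : 0 ≤ (1 + ‖φ b.src‖) ^ 2 := by positivity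
          have h5 : 0 ≤ (1 + ‖φ b.tgt‖) ^ 2 := by positivity
          exact mul_le_mul_of_nonneg_right (mul_le_mul_of_nonneg_right h2 h4) h5

/-- **A bounded function** (`|F| ≤ C`, e.g. any bounded function of the gauge field alone) has polynomial growth with `n = 0`.
[cite: BalabanImbrieJaffe1988, (3.1) p.265] -/
theorem norm_le_mul_prod_of_bounded {C : ℝ} {F : GaugeField P j U1 → HiggsField P j → ℂ} (hF : ∀ U φ, ‖F U φ‖ ≤ C)
    (U : GaugeField P j U1) (φ : HiggsField P j) :
    ‖F U φ‖ ≤ C * ∏ x : Balaban1983to89.Site P j, (1 + ‖φ x‖) ^ 0 := by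
  simpa using hF U φ

/-- **The factor `Re(ieε²)^{−1}(u(p) − 1)` of (3.1)** has polynomial growth (`n = 0`, `C = 2|(ieε²)^{−1}|`: `|u(p) − 1| ≤ 2`).
[cite: BalabanImbrieJaffe1988, (3.1) p.265] -/
theorem norm_plaq_le (e ε : ℝ) (p : Balaban1983to89.Plaq P j) (U : GaugeField P j U1) (φ : HiggsField P j) :
    ‖(((((I * e * ε ^ 2)⁻¹ : ℂ) * (plaqVar (cfg U) p - 1)).re : ℂ))‖ ≤
      (2 * ‖((I * e * ε ^ 2)⁻¹ : ℂ)‖) * ∏ x : Balaban1983to89.Site P j, (1 + ‖φ x‖) ^ 0 := by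
  refine norm_le_mul_prod_of_bounded (F := fun U _ => ((((I * e * ε ^ 2)⁻¹ : ℂ) * (plaqVar (cfg U) p - 1)).re : ℂ))
    (fun U _ => ?_) U φ
  rw [Complex.norm_real, Real.norm_eq_abs]
  refine (Complex.abs_re_le_norm _).trans ?_
  rw [norm_mul]
  have h1 : ‖plaqVar (cfg U) p - 1‖ ≤ 2 := by
    refine (norm_sub_le _ _).trans ?_
    rw [norm_plaqVar_cfg, norm_one]
    norm_num
  have h2 := norm_nonneg ((I * e * ε ^ 2)⁻¹ : ℂ)
  nlinarith

/-- **Products keep polynomial growth** (`C·C′`, `n + n′`) — so every finite product of the factors of (3.1) has it.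
[cite: BalabanImbrieJaffe1988, (3.1) p.265] -/
theorem norm_mul_le_of_le {C C' : ℝ} {n n' : ℕ} {F G : GaugeField P j U1 → HiggsField P j → ℂ}
    (hF : ∀ U φ, ‖F U φ‖ ≤ C * ∏ x : Balaban1983to89.Site P j, (1 + ‖φ x‖) ^ n)
    (hG : ∀ U φ, ‖G U φ‖ ≤ C' * ∏ x : Balaban1983to89.Site P j, (1 + ‖φ x‖) ^ n') (U : GaugeField P j U1) (φ : HiggsField P j) :
    ‖F U φ * G U φ‖ ≤ (C * C') * ∏ x : Balaban1983to89.Site P j, (1 + ‖φ x‖) ^ (n + n') := by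
  have h1 := hF U φ
  have h2 := hG U φ
  have hC : 0 ≤ C := by
    have := one_le_prod_pow n φ; have := norm_nonneg (F U φ); nlinarith
  rw [norm_mul]
  calc ‖F U φ‖ * ‖G U φ‖ ≤ (C * ∏ x, (1 + ‖φ x‖) ^ n) * (C' * ∏ x, (1 + ‖φ x‖) ^ n') :=
        mul_le_mul h1 h2 (norm_nonneg _) (mul_nonneg hC (le_trans zero_le_one (one_le_prod_pow n φ)))
    _ = C * C' * ∏ x : Balaban1983to89.Site P j, (1 + ‖φ x‖) ^ (n + n') := by
        rw [mul_mul_mul_comm, ← prod_mul_distrib]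
        simp_rw [← pow_add]

/-- **Polynomial growth is stable under the rescaling `φ ↦ sφ` of (3.6)** (`s = ε^{−(d−2)/2} ≥ 0`): `1 + s|φ| ≤ max(1,s)(1 + |φ|)`, so the
constant becomes `C·max(1,s)^{n|T|}`. [cite: BalabanImbrieJaffe1988, (3.6) p.266] -/
theorem norm_smul_le_of_le {C : ℝ} {n : ℕ} {F : GaugeField P j U1 → HiggsField P j → ℂ}
    (hF : ∀ U φ, ‖F U φ‖ ≤ C * ∏ x : Balaban1983to89.Site P j, (1 + ‖φ x‖) ^ n) {s : ℝ} (hs : 0 ≤ s)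
    (U : GaugeField P j U1) (φ : HiggsField P j) :
    ‖F U (s • φ)‖ ≤ (C * (max 1 s) ^ (n * Fintype.card (Balaban1983to89.Site P j))) *
      ∏ x : Balaban1983to89.Site P j, (1 + ‖φ x‖) ^ n := by
  have hC : 0 ≤ C := by
    have := one_le_prod_pow n (s • φ); have := norm_nonneg (F U (s • φ)); nlinarith [hF U (s • φ)]
  refine (hF U (s • φ)).trans ?_
  have key : ∀ x : Balaban1983to89.Site P j, (1 + ‖(s • φ) x‖) ^ n ≤ (max 1 s) ^ n * (1 + ‖φ x‖) ^ n := by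
    intro x
    rw [← mul_pow]
    refine pow_le_pow_left₀ (by positivity) ?_ n
    rw [Pi.smul_apply, norm_smul, Real.norm_eq_abs, abs_of_nonneg hs]
    have h1 : (1 : ℝ) ≤ max 1 s := le_max_left _ _
    have h2 : s ≤ max 1 s := le_max_right _ _
    have h3 := norm_nonneg (φ x)
    nlinarith
  calc C * ∏ x, (1 + ‖(s • φ) x‖) ^ n ≤ C * ∏ x, ((max 1 s) ^ n * (1 + ‖φ x‖) ^ n) :=
        mul_le_mul_of_nonneg_left (prod_le_prod (fun x _ => by positivity) fun x _ => key x) hC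
    _ = C * (max 1 s) ^ (n * Fintype.card (Balaban1983to89.Site P j)) * ∏ x, (1 + ‖φ x‖) ^ n := by
        rw [prod_mul_distrib, prod_const, Finset.card_univ, ← pow_mul, mul_assoc]

/-! ## §3 Integrability of `ρ₀ = F e^{−S}` (3.6)–(3.7) -/

/-- kernel: the one-site weight `(1 + |z|)ⁿ e^{−a|z|²} ≤ e^{n²/(2a)} e^{−(a/2)|z|²}` (`1 + r ≤ e^r`, `nr ≤ (a/2)r² + n²/(2a)`).
[cite: BalabanImbrieJaffe1988, (3.6) p.266] -/
theorem pow_mul_exp_le {a : ℝ} (ha : 0 < a) (n : ℕ) (z : ℂ) :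
    (1 + ‖z‖) ^ n * Real.exp (-a * ‖z‖ ^ 2) ≤ Real.exp ((n : ℝ) ^ 2 / (2 * a)) * Real.exp (-(a / 2) * ‖z‖ ^ 2) := by
  have hr := norm_nonneg z
  have h1 : (1 + ‖z‖) ^ n ≤ Real.exp ((n : ℝ) * ‖z‖) := by
    rw [Real.exp_nat_mul]
    exact pow_le_pow_left₀ (by positivity) (by have := Real.add_one_le_exp ‖z‖; linarith) n
  have h2 : (n : ℝ) * ‖z‖ ≤ (a / 2) * ‖z‖ ^ 2 + (n : ℝ) ^ 2 / (2 * a) := by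
    have h : 0 ≤ (a / 2) * (‖z‖ - n / a) ^ 2 := by positivity
    have e : (a / 2) * (‖z‖ - n / a) ^ 2 = (a / 2) * ‖z‖ ^ 2 - (n : ℝ) * ‖z‖ + (n : ℝ) ^ 2 / (2 * a) := by
      field_simp
      ring
    linarith
  calc (1 + ‖z‖) ^ n * Real.exp (-a * ‖z‖ ^ 2) ≤ Real.exp ((n : ℝ) * ‖z‖) * Real.exp (-a * ‖z‖ ^ 2) :=
        mul_le_mul_of_nonneg_right h1 (Real.exp_pos _).le
    _ = Real.exp ((n : ℝ) * ‖z‖ + -a * ‖z‖ ^ 2) := (Real.exp_add _ _).symm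
    _ ≤ Real.exp ((n : ℝ) ^ 2 / (2 * a) + -(a / 2) * ‖z‖ ^ 2) := Real.exp_le_exp.2 (by linarith)
    _ = _ := Real.exp_add _ _

/-- kernel: **the one-site weight is integrable on `ℂ`** (dominated by a complex Gaussian; `∫_ℂ e^{−b|z|²} = π/b`).
[cite: BalabanImbrieJaffe1988, (3.6) p.266] -/
theorem integrable_oneSite {a : ℝ} (ha : 0 < a) (n : ℕ) :
    Integrable (fun z : ℂ => (1 + ‖z‖) ^ n * Real.exp (-a * ‖z‖ ^ 2)) := by
  have ha2 : 0 < a / 2 := by positivity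
  have hg0 : Integrable (fun z : ℂ => Real.exp (-(a / 2) * ‖z‖ ^ 2)) := by
    apply Integrable.of_integral_ne_zero
    rw [GaussianFourier.integral_rexp_neg_mul_sq_norm ha2, Complex.finrank_real_complex]
    positivity
  have hg : Integrable (fun z : ℂ => Real.exp ((n : ℝ) ^ 2 / (2 * a)) * Real.exp (-(a / 2) * ‖z‖ ^ 2)) := hg0.const_mul _
  refine hg.mono' ?_ (ae_of_all _ fun z => ?_)
  · exact (((continuous_const.add continuous_norm).pow n).mul
      (Real.continuous_exp.comp (continuous_const.mul (continuous_norm.pow 2)))).aestronglyMeasurable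
  · rw [Real.norm_eq_abs, abs_of_nonneg (by positivity)]
    exact pow_mul_exp_le ha n z

/-- **THE DOMINATION of `ρ₀`**: for `ε > 0`, `λ > 0` and `|F(u, φ)| ≤ CΠ_x(1 + |φ(x)|)ⁿ`,
`|ρ₀(u, φ)| ≤ A · Π_x (1 + |φ(x)|)ⁿ e^{−a|φ(x)|²}` with `a = ε^d s²`, `s = ε^{−(d−2)/2}` the rescaling of (3.6), and the constant
`A = e^{−(ℰ₀ + E₁) + |T|ε^dK} · C · max(1,s)^{n|T|}`, `K = (5/4 + δm²/2)²/(4λ)` — from `actionU1_ge` at the rescaled field.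
[cite: BalabanImbrieJaffe1988, (3.6) p.266] -/
theorem norm_rho0_le {ε : ℝ} (hε : 0 < ε) (e : ℝ) {lam : ℝ} (hlam : 0 < lam) (dm2 E₀ E₁ : ℝ)
    {F : GaugeField P j U1 → HiggsField P j → ℂ} {C : ℝ} {n : ℕ}
    (hF : ∀ U φ, ‖F U φ‖ ≤ C * ∏ x : Balaban1983to89.Site P j, (1 + ‖φ x‖) ^ n) (U : GaugeField P j U1)
    (φ : HiggsField P j) :
    ‖rho0 ε e lam dm2 E₀ E₁ F U φ‖ ≤
      (Real.exp (-(calE0 E₀ P.d (Fintype.card (Balaban1983to89.Site P j)) ε + E₁)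
          + Fintype.card (Balaban1983to89.Site P j) * (ε ^ P.d * ((5 / 4 + dm2 / 2) ^ 2 / (4 * lam))))
        * (C * (max 1 (phiScale ε P.d)) ^ (n * Fintype.card (Balaban1983to89.Site P j)))) *
      ∏ x : Balaban1983to89.Site P j, ((1 + ‖φ x‖) ^ n * Real.exp (-(ε ^ P.d * phiScale ε P.d ^ 2) * ‖φ x‖ ^ 2)) := by
  set s := phiScale ε P.d with hs_def
  set w : ℝ := ε ^ P.d with hw_def
  set K : ℝ := (5 / 4 + dm2 / 2) ^ 2 / (4 * lam) with hK_def
  set E₀' : ℝ := calE0 E₀ P.d (Fintype.card (Balaban1983to89.Site P j)) ε with hE_def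
  set N : ℕ := Fintype.card (Balaban1983to89.Site P j) with hN_def
  have hs0 : 0 < s := phiScale_pos hε P.d
  have hw : 0 ≤ w := by positivity
  -- the stability bound at the rescaled field
  have hS := actionU1_ge hw ε⁻¹ e hlam dm2 E₀' E₁ U (s • φ)
  have hsum : ∑ x : Balaban1983to89.Site P j, w * (‖(s • φ) x‖ ^ 2 - K) =
      ∑ x : Balaban1983to89.Site P j, (w * s ^ 2 * ‖φ x‖ ^ 2 - w * K) :=
    sum_congr rfl fun x _ => by
      rw [Pi.smul_apply, norm_smul, Real.norm_eq_abs, abs_of_pos hs0, mul_pow]; ring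
  rw [hsum, Finset.sum_sub_distrib, sum_const, card_univ, ← hN_def, nsmul_eq_mul] at hS
  -- the growth of the rescaled observable
  have hF' := norm_smul_le_of_le hF hs0.le U φ
  rw [← hN_def] at hF'
  -- the density
  have hrho : ‖rho0 ε e lam dm2 E₀ E₁ F U φ‖ =
      Real.exp (-(actionU1 w ε⁻¹ e lam dm2 E₀' E₁ U (s • φ))) * ‖F U (s • φ)‖ := by
    unfold rho0
    rw [norm_mul, Complex.norm_real, Real.norm_eq_abs, abs_of_pos (Real.exp_pos _)]
  rw [hrho]
  have hexp : Real.exp (-(actionU1 w ε⁻¹ e lam dm2 E₀' E₁ U (s • φ))) ≤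
      Real.exp (-(E₀' + E₁) + N * (w * K)) * ∏ x : Balaban1983to89.Site P j, Real.exp (-(w * s ^ 2) * ‖φ x‖ ^ 2) := by
    rw [← Real.exp_sum, ← Real.exp_add]
    apply Real.exp_le_exp.2
    have e1 : ∑ x : Balaban1983to89.Site P j, (-(w * s ^ 2) * ‖φ x‖ ^ 2) =
        -(∑ x : Balaban1983to89.Site P j, w * s ^ 2 * ‖φ x‖ ^ 2) := by
      rw [← Finset.sum_neg_distrib]
      exact sum_congr rfl fun x _ => by ring
    rw [e1]
    linarith
  have hA : 0 ≤ Real.exp (-(E₀' + E₁) + N * (w * K)) * ∏ x : Balaban1983to89.Site P j, Real.exp (-(w * s ^ 2) * ‖φ x‖ ^ 2) :=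
    mul_nonneg (Real.exp_pos _).le (prod_nonneg fun x _ => (Real.exp_pos _).le)
  calc Real.exp (-(actionU1 w ε⁻¹ e lam dm2 E₀' E₁ U (s • φ))) * ‖F U (s • φ)‖
      ≤ (Real.exp (-(E₀' + E₁) + N * (w * K)) * ∏ x : Balaban1983to89.Site P j, Real.exp (-(w * s ^ 2) * ‖φ x‖ ^ 2)) *
          (C * (max 1 s) ^ (n * N) * ∏ x : Balaban1983to89.Site P j, (1 + ‖φ x‖) ^ n) :=
        mul_le_mul hexp hF' (norm_nonneg _) hA
    _ = _ := by
        rw [prod_mul_distrib]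
        ring

/-- **INTEGRABILITY of `ρ₀ = F e^{−S}` for `𝒟u𝒟φ`** ((3.6): `[F] = ∫𝒟u𝒟φ ρ₀(u, φ)` is an honest Lebesgue–Haar integral): for `ε > 0`, `λ > 0`
and every jointly measurable observable of polynomial growth `|F(u, φ)| ≤ CΠ_x(1 + |φ(x)|)ⁿ` (all products of the factors of (3.1)), the density
`rho0 ε e λ δm² E₀ E₁ F` of r18's `BIJ88RenormTransf311` is integrable w.r.t. `fieldMeasure P j U1 ⊗ volume` — the hypothesis `hFi` of
r18's `eq313` / p34's `isRT311_rt`, `eq313_rt`. [cite: BalabanImbrieJaffe1988, (3.6) p.266] -/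
theorem integrable_rho0 {ε : ℝ} (hε : 0 < ε) (e : ℝ) {lam : ℝ} (hlam : 0 < lam) (dm2 E₀ E₁ : ℝ)
    {F : GaugeField P j U1 → HiggsField P j → ℂ} (hFm : Measurable (Function.uncurry F)) {C : ℝ} {n : ℕ}
    (hF : ∀ U φ, ‖F U φ‖ ≤ C * ∏ x : Balaban1983to89.Site P j, (1 + ‖φ x‖) ^ n) :
    Integrable (Function.uncurry (rho0 ε e lam dm2 E₀ E₁ F)) ((fieldMeasure P j U1).prod volume) := by
  have ha : 0 < ε ^ P.d * phiScale ε P.d ^ 2 := by have := phiScale_pos hε P.d; positivity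
  set A : ℝ := Real.exp (-(calE0 E₀ P.d (Fintype.card (Balaban1983to89.Site P j)) ε + E₁)
          + Fintype.card (Balaban1983to89.Site P j) * (ε ^ P.d * ((5 / 4 + dm2 / 2) ^ 2 / (4 * lam))))
        * (C * (max 1 (phiScale ε P.d)) ^ (n * Fintype.card (Balaban1983to89.Site P j))) with hA_def
  have hg1 : Integrable (fun φ : HiggsField P j => ∏ x : Balaban1983to89.Site P j,
      ((1 + ‖φ x‖) ^ n * Real.exp (-(ε ^ P.d * phiScale ε P.d ^ 2) * ‖φ x‖ ^ 2))) volume :=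
    Integrable.fintype_prod (f := fun (_ : Balaban1983to89.Site P j) (z : ℂ) =>
      (1 + ‖z‖) ^ n * Real.exp (-(ε ^ P.d * phiScale ε P.d ^ 2) * ‖z‖ ^ 2)) fun _ => integrable_oneSite ha n
  have hg : Integrable (fun p : GaugeField P j U1 × HiggsField P j => A * ∏ x : Balaban1983to89.Site P j,
      ((1 + ‖p.2 x‖) ^ n * Real.exp (-(ε ^ P.d * phiScale ε P.d ^ 2) * ‖p.2 x‖ ^ 2))) ((fieldMeasure P j U1).prod volume) :=
    (integrable_const A).mul_prod hg1
  refine hg.mono' (measurable_rho0 ε e lam dm2 E₀ E₁ hFm).aestronglyMeasurable (ae_of_all _ fun p => ?_)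
  exact norm_rho0_le hε e hlam dm2 E₀ E₁ hF p.1 p.2

end

end Literature.MathematicalPhysics.QuantumFieldTheory.BalabanImbrieJaffe1984to88.BIJ88Rho0Integrable
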